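import Mathlib
import HarnessLib
import Summits.RiemannHypothesis.RiemannHypothesis.Theorems.DbrWallAntipersistenceLogEleven

/-!
# DBR column, rung B-P(P1): elementary constants for the anti-persistence certificate at mesh `(log 13)/2`

RH-FREE elementary inequalities (LINE 1 of the label discipline): bounds on `13^{1/4}`, `log(13/8)`, `log(13/9)`, `log(13/11)` and
on the prime terms of the two-point gap at `s₁ = (log 13)/2`; used by `DbrWallAntipersistenceLogThirteen`
(`Ψ(2s) < 2Ψ(s)` for `0 < s ≤ (log 13)/2`). Nothing here bears on the truth of RH.

Method [folklore]: `ρ⁴ = 13` by `exp_log`; logarithms from `Real.abs_log_sub_add_sum_range_le` (series of `−log(1 − x)` at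
`x = 5/13, 4/13, 2/13`) combined with the earlier rungs' bounds (`log(13/4) = log 2 + log(13/8)`, `log(13/5) = log(13/8) + log(8/5)`,
`log(13/7) = log(13/8) + log(8/7)`, `log 11 = 3 log 2 + log(11/8)`), Mathlib's `Real.log_two_gt_d9`, and `√q < c` from `(√q)² = q`. -/

set_option linter.dupNamespace false

noncomputable section

open scoped BigOperators
open Set
namespace Summit.RiemannHypothesis.RiemannHypothesis.Theorems.DbrWall

open Literature.NumberTheory.LFunctions

/-- `ρ := e^{(log 13)/4} = 13^{1/4}`: `ρ⁴ = 13` and `1.898828 < ρ < 1.898829`. [folklore] -/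
theorem exp_log_thirteen_div_four_bounds :
    Real.exp (Real.log 13 / 4) ^ 4 = 13 ∧ (1.898828 : ℝ) < Real.exp (Real.log 13 / 4)
      ∧ Real.exp (Real.log 13 / 4) < 1.898829 := by
  set r := Real.exp (Real.log 13 / 4) with hr
  have hr0 : 0 < r := Real.exp_pos _
  have hr4 : r ^ 4 = 13 := by
    rw [← Real.exp_nat_mul, show ((4 : ℕ) : ℝ) * (Real.log 13 / 4) = Real.log 13 by push_cast; ring,
      Real.exp_log (by norm_num)]
  refine ⟨hr4, ?_, ?_⟩
  · by_contra h
    push Not at h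
    have := pow_le_pow_left₀ hr0.le h 4
    rw [hr4] at this
    norm_num at this
  · by_contra h
    push Not at h
    have := pow_le_pow_left₀ (by norm_num) h 4
    rw [hr4] at this
    norm_num at this

/-- The gap exponentials at `s₁ = (log 13)/2`: `e^{−λ'_k s₁} = 13^{−(k+1)}·ρ⁻¹`. [folklore] -/
theorem exp_neg_lam_mul_half_log_thirteen (k : ℕ) :
    Real.exp (-((2 * (k : ℝ) + 5 / 2) * (Real.log 13 / 2)))
      = (1 / 13 : ℝ) ^ (k + 1) * (Real.exp (Real.log 13 / 4))⁻¹ := by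
  set r := Real.exp (Real.log 13 / 4) with hr
  have hr4 := exp_log_thirteen_div_four_bounds.1
  have h1 : Real.exp (-((2 * (k : ℝ) + 5 / 2) * (Real.log 13 / 2))) = r⁻¹ ^ (4 * k + 5) := by
    rw [show (2 * (k : ℝ) + 5 / 2) * (Real.log 13 / 2) = ((4 * k + 5 : ℕ) : ℝ) * (Real.log 13 / 4) by
      push_cast; ring, Real.exp_neg, Real.exp_nat_mul, inv_pow]
  have h2 : r⁻¹ ^ (4 * k + 5) = (r⁻¹ ^ 4) ^ (k + 1) * r⁻¹ := by ring
  have h3 : r⁻¹ ^ 4 = 1 / 13 := by rw [inv_pow, hr4, one_div]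
  rw [h1, h2, h3]

/-- `log(13/8) > 0.4855078` (twenty terms of `−log(1 − 5/13)`). [folklore] -/
theorem log_thirteen_eighths_gt : (0.4855078 : ℝ) < Real.log (13 / 8) := by
  have hx : |(5 / 13 : ℝ)| < 1 := by rw [abs_of_pos (by norm_num)]; norm_num
  have h := Real.abs_log_sub_add_sum_range_le hx 20
  have hlog : Real.log (1 - 5 / 13 : ℝ) = -Real.log (13 / 8) := by
    rw [show (1 - 5 / 13 : ℝ) = (13 / 8)⁻¹ by norm_num, Real.log_inv]
  rw [hlog, abs_of_pos (by norm_num : (0 : ℝ) < 5 / 13)] at h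
  have h' := (abs_le.1 h).2
  simp only [Finset.sum_range_succ, Finset.sum_range_zero] at h'
  norm_num at h'
  linarith

/-- `log(13/9) > 0.3677247` (sixteen terms of `−log(1 − 4/13)`). [folklore] -/
theorem log_thirteen_ninths_gt : (0.3677247 : ℝ) < Real.log (13 / 9) := by
  have hx : |(4 / 13 : ℝ)| < 1 := by rw [abs_of_pos (by norm_num)]; norm_num
  have h := Real.abs_log_sub_add_sum_range_le hx 16
  have hlog : Real.log (1 - 4 / 13 : ℝ) = -Real.log (13 / 9) := by
    rw [show (1 - 4 / 13 : ℝ) = (13 / 9)⁻¹ by norm_num, Real.log_inv]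
  rw [hlog, abs_of_pos (by norm_num : (0 : ℝ) < 4 / 13)] at h
  have h' := (abs_le.1 h).2
  simp only [Finset.sum_range_succ, Finset.sum_range_zero] at h'
  norm_num at h'
  linarith

/-- `log(13/11) > 0.167054` (ten terms of `−log(1 − 2/13)`). [folklore] -/
theorem log_thirteen_elevenths_gt : (0.167054 : ℝ) < Real.log (13 / 11) := by
  have hx : |(2 / 13 : ℝ)| < 1 := by rw [abs_of_pos (by norm_num)]; norm_num
  have h := Real.abs_log_sub_add_sum_range_le hx 10
  have hlog : Real.log (1 - 2 / 13 : ℝ) = -Real.log (13 / 11) := by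
    rw [show (1 - 2 / 13 : ℝ) = (13 / 11)⁻¹ by norm_num, Real.log_inv]
  rw [hlog, abs_of_pos (by norm_num : (0 : ℝ) < 2 / 13)] at h
  have h' := (abs_le.1 h).2
  simp only [Finset.sum_range_succ, Finset.sum_range_zero] at h'
  norm_num at h'
  linarith

/-- The prime terms at `s₁ = (log 13)/2` in the affine form: they equal `(log 2)²/√2 + (log 3)²/√3 + (log 2/2)·log(13/4)
+ (log 5/√5)·log(13/5) + (log 7/√7)·log(13/7) + (log 2/√8)·log(13/8) + (log 3/3)·log(13/9) + (log 11/√11)·log(13/11) > 2.9622`.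
[folklore] -/
theorem prime_terms_half_log_thirteen_gt :
    (2.9622 : ℝ) < Real.log 2 / Real.sqrt 2 * (2 * (Real.log 13 / 2) - Real.log 2)
      + ((2 * (Real.log 3 / Real.sqrt 3) + Real.log 2 + 2 * (Real.log 5 / Real.sqrt 5)
          + 2 * (Real.log 7 / Real.sqrt 7) + 2 * (Real.log 2 / Real.sqrt 8) + 2 * (Real.log 3 / 3)
          + 2 * (Real.log 11 / Real.sqrt 11)
          - 2 * (Real.log 2 / Real.sqrt 2) - 2 * (Real.log 3 / Real.sqrt 3)) * (Real.log 13 / 2)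
        + (-(Real.log 3 / Real.sqrt 3 * Real.log 3) - Real.log 2 / 2 * Real.log 4
          - Real.log 5 / Real.sqrt 5 * Real.log 5 - Real.log 7 / Real.sqrt 7 * Real.log 7
          - Real.log 2 / Real.sqrt 8 * Real.log 8 - Real.log 3 / 3 * Real.log 9 - Real.log 11 / Real.sqrt 11 * Real.log 11
          + 2 * (Real.log 2 / Real.sqrt 2) * Real.log 2 + 2 * (Real.log 3 / Real.sqrt 3) * Real.log 3)) := by
  -- square-root bounds first (small context keeps `nlinarith` cheap)
  have hs2 : 0 < Real.sqrt 2 := Real.sqrt_pos.2 (by norm_num)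
  have hs3 : 0 < Real.sqrt 3 := Real.sqrt_pos.2 (by norm_num)
  have hs5 : 0 < Real.sqrt 5 := Real.sqrt_pos.2 (by norm_num)
  have hs7 : 0 < Real.sqrt 7 := Real.sqrt_pos.2 (by norm_num)
  have hs8 : 0 < Real.sqrt 8 := Real.sqrt_pos.2 (by norm_num)
  have hs11 : 0 < Real.sqrt 11 := Real.sqrt_pos.2 (by norm_num)
  have hs2u : Real.sqrt 2 < 1.41422 := by
    have h := Real.sq_sqrt (show (0 : ℝ) ≤ 2 by norm_num)
    nlinarith [Real.sqrt_nonneg 2]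
  have hs3u : Real.sqrt 3 < 1.73206 := by
    have h := Real.sq_sqrt (show (0 : ℝ) ≤ 3 by norm_num)
    nlinarith [Real.sqrt_nonneg 3]
  have hs5u : Real.sqrt 5 < 2.23607 := by
    have h := Real.sq_sqrt (show (0 : ℝ) ≤ 5 by norm_num)
    nlinarith [Real.sqrt_nonneg 5]
  have hs7u : Real.sqrt 7 < 2.64576 := by
    have h := Real.sq_sqrt (show (0 : ℝ) ≤ 7 by norm_num)
    nlinarith [Real.sqrt_nonneg 7]
  have hs8u : Real.sqrt 8 < 2.82843 := by
    have h := Real.sq_sqrt (show (0 : ℝ) ≤ 8 by norm_num)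
    nlinarith [Real.sqrt_nonneg 8]
  have hs11u : Real.sqrt 11 < 3.31663 := by
    have h := Real.sq_sqrt (show (0 : ℝ) ≤ 11 by norm_num)
    nlinarith [Real.sqrt_nonneg 11]
  have h9 : Real.log 9 = 2 * Real.log 3 := by
    rw [show (9 : ℝ) = 3 ^ 2 by norm_num, Real.log_pow]; norm_num
  have h4 : Real.log 4 = 2 * Real.log 2 := by
    rw [show (4 : ℝ) = 2 ^ 2 by norm_num, Real.log_pow]; norm_num
  have h8 : Real.log 8 = 3 * Real.log 2 := by
    rw [show (8 : ℝ) = 2 ^ 3 by norm_num, Real.log_pow]; norm_num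
  have h138 : Real.log (13 / 8) = Real.log 13 - Real.log 8 := Real.log_div (by norm_num) (by norm_num)
  have h139 : Real.log (13 / 9) = Real.log 13 - Real.log 9 := Real.log_div (by norm_num) (by norm_num)
  have h1311 : Real.log (13 / 11) = Real.log 13 - Real.log 11 := Real.log_div (by norm_num) (by norm_num)
  have h118 : Real.log (11 / 8) = Real.log 11 - Real.log 8 := Real.log_div (by norm_num) (by norm_num)
  have h85 : Real.log (8 / 5) = Real.log 8 - Real.log 5 := Real.log_div (by norm_num) (by norm_num)
  have h87 : Real.log (8 / 7) = Real.log 8 - Real.log 7 := Real.log_div (by norm_num) (by norm_num)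
  have hgoal : Real.log 2 / Real.sqrt 2 * (2 * (Real.log 13 / 2) - Real.log 2)
      + ((2 * (Real.log 3 / Real.sqrt 3) + Real.log 2 + 2 * (Real.log 5 / Real.sqrt 5)
          + 2 * (Real.log 7 / Real.sqrt 7) + 2 * (Real.log 2 / Real.sqrt 8) + 2 * (Real.log 3 / 3)
          + 2 * (Real.log 11 / Real.sqrt 11)
          - 2 * (Real.log 2 / Real.sqrt 2) - 2 * (Real.log 3 / Real.sqrt 3)) * (Real.log 13 / 2)
        + (-(Real.log 3 / Real.sqrt 3 * Real.log 3) - Real.log 2 / 2 * Real.log 4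
          - Real.log 5 / Real.sqrt 5 * Real.log 5 - Real.log 7 / Real.sqrt 7 * Real.log 7
          - Real.log 2 / Real.sqrt 8 * Real.log 8 - Real.log 3 / 3 * Real.log 9 - Real.log 11 / Real.sqrt 11 * Real.log 11
          + 2 * (Real.log 2 / Real.sqrt 2) * Real.log 2 + 2 * (Real.log 3 / Real.sqrt 3) * Real.log 3))
      = Real.log 2 / Real.sqrt 2 * Real.log 2 + Real.log 3 / Real.sqrt 3 * Real.log 3
        + Real.log 2 / 2 * (Real.log 2 + Real.log (13 / 8))
        + Real.log 5 / Real.sqrt 5 * (Real.log (13 / 8) + Real.log (8 / 5))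
        + Real.log 7 / Real.sqrt 7 * (Real.log (13 / 8) + Real.log (8 / 7))
        + Real.log 2 / Real.sqrt 8 * Real.log (13 / 8) + Real.log 3 / 3 * Real.log (13 / 9)
        + Real.log 11 / Real.sqrt 11 * Real.log (13 / 11) := by
    rw [h138, h139, h1311, h85, h87, h9, h4, h8]; ring
  rw [hgoal]
  have hl2 := Real.log_two_gt_d9
  have hl32 := log_three_halves_gt
  have hl138 := log_thirteen_eighths_gt
  have hl139 := log_thirteen_ninths_gt
  have hl1311 := log_thirteen_elevenths_gt
  have hl118 := log_eleven_eighths_gt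
  have hl85 := log_eight_fifths_gt
  have hl87 := log_eight_sevenths_gt
  have hl3 : (1.09852 : ℝ) < Real.log 3 := by
    have e : Real.log 3 = Real.log 2 + Real.log (3 / 2) := by
      rw [Real.log_div (by norm_num) (by norm_num)]; ring
    linarith only [e, hl2, hl32]
  have hl5 : (1.609436 : ℝ) < Real.log 5 := by
    have h := log_five_fourths_gt
    have e : Real.log 5 = 2 * Real.log 2 + Real.log (5 / 4) := by
      rw [Real.log_div (by norm_num) (by norm_num), show (4 : ℝ) = 2 ^ 2 by norm_num, Real.log_pow]
      push_cast; ring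
    linarith only [e, h, hl2]
  have hl7 : (1.945908 : ℝ) < Real.log 7 := by
    have h := log_seven_fifths_gt
    have e : Real.log 7 = Real.log 5 + Real.log (7 / 5) := by
      rw [Real.log_div (by norm_num) (by norm_num)]; ring
    linarith only [e, h, hl5]
  have hl11 : (2.3978952 : ℝ) < Real.log 11 := by
    have e : Real.log 11 = Real.log 8 + Real.log (11 / 8) := by linarith only [h118]
    linarith only [e, h8, hl2, hl118]
  have hl134 : (1.1786549 : ℝ) < Real.log 2 + Real.log (13 / 8) := by linarith only [hl2, hl138]
  have hl135 : (0.9555113 : ℝ) ≤ Real.log (13 / 8) + Real.log (8 / 5) := by linarith only [hl138, hl85]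
  have hl137 : (0.6190391 : ℝ) ≤ Real.log (13 / 8) + Real.log (8 / 7) := by linarith only [hl138, hl87]
  have hp2 : (0.6931471803 : ℝ) * 0.6931471803 ≤ Real.log 2 * Real.log 2 :=
    mul_le_mul hl2.le hl2.le (by norm_num) (by linarith only [hl2])
  have hA : (0.33972 : ℝ) < Real.log 2 / Real.sqrt 2 * Real.log 2 := by
    rw [div_mul_eq_mul_div, lt_div_iff₀ hs2]
    have hq := mul_lt_mul_of_pos_left hs2u (show (0 : ℝ) < 0.33972 by norm_num)
    linarith only [hq, hp2]
  have hB : (0.69671 : ℝ) < Real.log 3 / Real.sqrt 3 * Real.log 3 := by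
    rw [div_mul_eq_mul_div, lt_div_iff₀ hs3]
    have hp : (1.09852 : ℝ) * 1.09852 ≤ Real.log 3 * Real.log 3 :=
      mul_le_mul hl3.le hl3.le (by norm_num) (by linarith only [hl3])
    have hq := mul_lt_mul_of_pos_left hs3u (show (0 : ℝ) < 0.69671 by norm_num)
    linarith only [hq, hp]
  have hC : (0.40848 : ℝ) < Real.log 2 / 2 * (Real.log 2 + Real.log (13 / 8)) := by
    have hp : (0.6931471803 : ℝ) * 1.1786549 ≤ Real.log 2 * (Real.log 2 + Real.log (13 / 8)) :=
      mul_le_mul hl2.le hl134.le (by norm_num) (by linarith only [hl2])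
    linarith only [hp]
  have hD : (0.68772 : ℝ) < Real.log 5 / Real.sqrt 5 * (Real.log (13 / 8) + Real.log (8 / 5)) := by
    rw [div_mul_eq_mul_div, lt_div_iff₀ hs5]
    have hp : (1.609436 : ℝ) * 0.9555113 ≤ Real.log 5 * (Real.log (13 / 8) + Real.log (8 / 5)) :=
      mul_le_mul hl5.le hl135 (by norm_num) (by linarith only [hl5])
    have hq := mul_lt_mul_of_pos_left hs5u (show (0 : ℝ) < 0.68772 by norm_num)
    linarith only [hp, hq]
  have hE : (0.45528 : ℝ) < Real.log 7 / Real.sqrt 7 * (Real.log (13 / 8) + Real.log (8 / 7)) := by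
    rw [div_mul_eq_mul_div, lt_div_iff₀ hs7]
    have hp : (1.945908 : ℝ) * 0.6190391 ≤ Real.log 7 * (Real.log (13 / 8) + Real.log (8 / 7)) :=
      mul_le_mul hl7.le hl137 (by norm_num) (by linarith only [hl7])
    have hq := mul_lt_mul_of_pos_left hs7u (show (0 : ℝ) < 0.45528 by norm_num)
    linarith only [hp, hq]
  have hF : (0.11897 : ℝ) < Real.log 2 / Real.sqrt 8 * Real.log (13 / 8) := by
    rw [div_mul_eq_mul_div, lt_div_iff₀ hs8]
    have hp : (0.6931471803 : ℝ) * 0.4855078 ≤ Real.log 2 * Real.log (13 / 8) :=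
      mul_le_mul hl2.le hl138.le (by norm_num) (by linarith only [hl2])
    have hq := mul_lt_mul_of_pos_left hs8u (show (0 : ℝ) < 0.11897 by norm_num)
    linarith only [hp, hq]
  have hG : (0.13464 : ℝ) < Real.log 3 / 3 * Real.log (13 / 9) := by
    have hp : (1.09852 : ℝ) * 0.3677247 ≤ Real.log 3 * Real.log (13 / 9) :=
      mul_le_mul hl3.le hl139.le (by norm_num) (by linarith only [hl3])
    linarith only [hp]
  have hH : (0.12076 : ℝ) < Real.log 11 / Real.sqrt 11 * Real.log (13 / 11) := by
    rw [div_mul_eq_mul_div, lt_div_iff₀ hs11]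
    have hp : (2.3978952 : ℝ) * 0.167054 ≤ Real.log 11 * Real.log (13 / 11) :=
      mul_le_mul hl11.le hl1311.le (by norm_num) (by linarith only [hl11])
    have hq := mul_lt_mul_of_pos_left hs11u (show (0 : ℝ) < 0.12076 by norm_num)
    linarith only [hp, hq]
  linarith only [hA, hB, hC, hD, hE, hF, hG, hH]

end Summit.RiemannHypothesis.RiemannHypothesis.Theorems.DbrWall
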